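import Summits.AtomisticToContinuum.HydrodynamicLimit.Theorems.RelayRaceLocalityRestartPrincipleC3EnergyOnly
import Summits.AtomisticToContinuum.HydrodynamicLimit.Theorems.ImplosionDichotomyHydroLimitInBandWindowContinuityStreaming
import HarnessLib

/-!
# Crux `RestartPrinciple` (stmt-AtomisticToContinuum-12503), line `IdeatorFourSketch` — the stub
# `stub_cubicMomentAlongFamily` REDUCED to a cubic velocity TAIL bound along the family

Support file (`--supports stmt-AtomisticToContinuum-12503`; registered sub-goal `c3_cubicMoment_of_cubicTail_family`).
With the energy-only facts of `…RestartPrincipleC3EnergyOnly` (cubic moments `≤ C √(N+1)` along the flow for every `N`,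
second moments uniformly bounded along the flow), the conclusion of `stub_cubicMomentAlongFamily` at a time `t < T` —
VERBATIM hypothesis (ii) of `mmr_energy_of_collisionFlux_of_cubicMoment` — follows from ANY bound, for `N ≥ N₀`, on the
cubic velocity TAIL beyond some level `M` along the flow-evolved local Gibbs laws of the family:
`E_{LG_τ}[(N+1)⁻¹ Σᵢ ‖vᵢ(Φ_r z)‖³ 𝟙{‖vᵢ(Φ_r z)‖ > M}] ≤ K` (`r, τ ∈ [0,t]`, `r + τ ≤ t`). Pointwise
`‖v‖³ ≤ M₊ ‖v‖² + ‖v‖³ 𝟙{‖v‖ > M}` (`HydroLimitInBandContinuity.norm_cube_le_indicator`, the same truncation as the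
streaming bound `lintegral_cubicSum_le` of crux `HydroLimitInBand` at `LG_0`); small `N < N₀` are paid by the `√(N+1)` bound. So the open content of the stub is
exactly a (family, `τ`-uniform) form of the cubic-tail crux `OneFlightGossipEngine.EnergyCurrentTails`
(stmt-AtomisticToContinuum-9235: uniform integrability of `‖v‖³` along the true evolution, open-problem grade — the
entropy inequality is void at order `3`, `Literature.Barriers.AtomisticToContinuum.lintegral_exp_cubic_eq_top`).

References: S. R. S. Varadhan, *Entropy methods in hydrodynamic scaling* (1993) §5; H. Spohn, *Large Scale Dynamics of
Interacting Particles* (1991) Part I §2.3.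
-/

noncomputable section

namespace Summit.AtomisticToContinuum.HydrodynamicLimit.Theorems.RestartPrinciple.AgeDuhamelForgetting

open scoped BigOperators Topology ENNReal
open MeasureTheory ProbabilityTheory Set Filter
open Literature.MathematicalPhysics.KineticTheory Literature.Analysis.FluidPDE Literature.Analysis.FunctionSpaces
open Summit.AtomisticToContinuum.HydrodynamicLimit.Theorems.NearConstantShortTimeHL

/-- The truncation of the cubic average along a flow, in `ℝ≥0∞`:
`ofReal (n⁻¹ Σ ‖vᵢ(r)‖³) ≤ ofReal (max M 0) · ofReal (n⁻¹ Σ ‖vᵢ(r)‖²) + ofReal (n⁻¹ Σ ‖vᵢ(r)‖³ 𝟙{‖vᵢ(r)‖ > M})`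
(pointwise `‖w‖³ ≤ M₊ ‖w‖² + ‖w‖³ 𝟙{‖w‖ > M}`, the landed `HydroLimitInBandContinuity.norm_cube_le_indicator`). [folklore] -/
theorem c3_ofReal_avg_pow_three_flow_le_truncate {ε : ℝ} {n : ℕ} (Φ : HardSphereFlow (Torus.geometry (Fin 3)) ε n)
    (M r : ℝ) (z : Config n (Fin 3) T3) :
    ENNReal.ofReal ((n : ℝ)⁻¹ * ∑ i, ‖(Φ.flow r z i).2‖ ^ 3) ≤
      ENNReal.ofReal (max M 0) * ENNReal.ofReal ((n : ℝ)⁻¹ * ∑ i, ‖(Φ.flow r z i).2‖ ^ 2) +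
        ENNReal.ofReal ((n : ℝ)⁻¹ * ∑ i, Set.indicator {v : V3 | M < ‖v‖} (fun v => ‖v‖ ^ 3) (Φ.flow r z i).2) := by
  have hn : (0 : ℝ) ≤ (n : ℝ)⁻¹ := inv_nonneg.2 (Nat.cast_nonneg n)
  have hM : (0 : ℝ) ≤ max M 0 := le_max_right _ _
  have hind : ∀ i, 0 ≤ Set.indicator {v : V3 | M < ‖v‖} (fun v => ‖v‖ ^ 3) (Φ.flow r z i).2 := fun i =>
    Set.indicator_nonneg (fun v _ => pow_nonneg (norm_nonneg v) 3) _
  have h2 : 0 ≤ (n : ℝ)⁻¹ * ∑ i, ‖(Φ.flow r z i).2‖ ^ 2 := mul_nonneg hn (Finset.sum_nonneg fun i _ => sq_nonneg _)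
  have h3 : 0 ≤ (n : ℝ)⁻¹ * ∑ i, Set.indicator {v : V3 | M < ‖v‖} (fun v => ‖v‖ ^ 3) (Φ.flow r z i).2 :=
    mul_nonneg hn (Finset.sum_nonneg fun i _ => hind i)
  rw [← ENNReal.ofReal_mul hM, ← ENNReal.ofReal_add (mul_nonneg hM h2) h3]
  refine ENNReal.ofReal_le_ofReal ?_
  calc (n : ℝ)⁻¹ * ∑ i, ‖(Φ.flow r z i).2‖ ^ 3
      ≤ (n : ℝ)⁻¹ * ∑ i, (max M 0 * ‖(Φ.flow r z i).2‖ ^ 2 +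
          Set.indicator {v : V3 | M < ‖v‖} (fun v => ‖v‖ ^ 3) (Φ.flow r z i).2) :=
        mul_le_mul_of_nonneg_left (Finset.sum_le_sum fun i _ =>
          HydroLimitInBandContinuity.norm_cube_le_indicator M _) hn
    _ = max M 0 * ((n : ℝ)⁻¹ * ∑ i, ‖(Φ.flow r z i).2‖ ^ 2) +
          (n : ℝ)⁻¹ * ∑ i, Set.indicator {v : V3 | M < ‖v‖} (fun v => ‖v‖ ^ 3) (Φ.flow r z i).2 := by
        rw [Finset.sum_add_distrib, ← Finset.mul_sum]
        ring

/-- The cubic tail average along a flow is measurable. [folklore] -/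
theorem c3_measurable_avg_tail_flow {ε : ℝ} {n : ℕ} (Φ : HardSphereFlow (Torus.geometry (Fin 3)) ε n) (M r : ℝ) :
    Measurable fun z : Config n (Fin 3) T3 =>
      ENNReal.ofReal ((n : ℝ)⁻¹ * ∑ i, Set.indicator {v : V3 | M < ‖v‖} (fun v => ‖v‖ ^ 3) (Φ.flow r z i).2) := by
  refine (measurable_const.mul (Finset.measurable_sum _ fun i _ => ?_)).ennreal_ofReal
  have hv : Measurable fun z : Config n (Fin 3) T3 => (Φ.flow r z i).2 :=
    ((measurable_pi_apply i).comp (Φ.measurable_flow r)).snd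
  exact ((measurable_norm.pow_const 3).indicator (measurableSet_lt measurable_const measurable_norm)).comp hv

/-- **Sub-goal `c3_cubicMoment_of_cubicTail_family`: `stub_cubicMomentAlongFamily` at `t` from a cubic TAIL bound along
the family.** For every `σ`, classical hard-sphere Euler solution on `[0,T)`, flows `Φ N`, continuous positive activity
family `a` and `t < T`: IF for some level `M`, constant `K` and `N₀` the flow-evolved local Gibbs laws of the family have
`E_{LG_τ}[(N+1)⁻¹ Σᵢ ‖vᵢ(Φ_r z)‖³ 𝟙{‖vᵢ(Φ_r z)‖ > M}] ≤ K` for `N ≥ N₀`, `r, τ ∈ [0,t]`, `r + τ ≤ t`, THEN there is `C₃` with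
`E_{LG_τ}[(N+1)⁻¹ Σᵢ ‖vᵢ(Φ_r z)‖³] ≤ C₃` for ALL `N` and the same `r, τ` (verbatim hypothesis (ii) of
`mmr_energy_of_collisionFlux_of_cubicMoment`): `C₃ = max (M₊ C₂ + |K|) (|C| √N₀)` with `C₂` the uniform second-moment bound
(`c3_sqMoment_flow_family`) and `C √(N+1)` the energy-only cubic bound (`c3_cubicMoment_flow_sqrt_family`).
[cite: Varadhan1993EntropyMethods, §5] -/
theorem c3_cubicMoment_of_cubicTail_family : ∀ (σ T : ℝ) (ρ θ : ℝ → T3 → ℝ) (u : ℝ → T3 → V3), IsHardSphereEulerSolution σ T ρ u θ → ∀ (Φ : (N : ℕ) → HardSphereFlow (Torus.geometry (Fin 3)) (hsDiameter σ N) (N + 1)) (a : ℝ → T3 → ℝ), (∀ τ ∈ Set.Ico 0 T, Continuous (a τ) ∧ ∀ x, 0 < a τ x) → ∀ t ∈ Set.Ico 0 T, (∃ M K : ℝ, ∃ N₀ : ℕ, ∀ N : ℕ, N₀ ≤ N → ∀ r ∈ Set.Icc 0 t, ∀ τ ∈ Set.Icc 0 t, r + τ ≤ t → ∫⁻ z,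 ENNReal.ofReal ((((N + 1 : ℕ) : ℝ))⁻¹ * ∑ i, Set.indicator {v : V3 | M < ‖v‖} (fun v => ‖v‖ ^ 3) (((Φ N).flow r z i).2)) ∂(localGibbsLaw σ (a τ) (u τ) (θ τ) N (Φ N)) ≤ ENNReal.ofReal K) → ∃ C3 : ℝ, ∀ N : ℕ, ∀ r ∈ Set.Icc 0 t, ∀ τ ∈ Set.Icc 0 t, r + τ ≤ t → ∫⁻ z, ENNReal.ofReal ((((N + 1 : ℕ) : ℝ))⁻¹ * ∑ i, ‖((Φ N).flow r z i).2‖ ^ 3) ∂(localGibbsLaw σ (a τ) (u τ) (θ τ) N (Φ N)) ≤ ENNReal.ofReal C3 := by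
  intro σ T ρ θ u hE Φ a hapos t ht htail
  obtain ⟨M, K, N₀, htail⟩ := htail
  obtain ⟨C, hC⟩ := c3_cubicMoment_flow_sqrt_family σ T ρ θ u hE Φ a hapos t ht
  obtain ⟨C2, hC2⟩ := c3_sqMoment_flow_family σ T ρ θ u hE Φ a hapos t ht
  have hM : (0 : ℝ) ≤ max M 0 := le_max_right _ _
  refine ⟨max (max M 0 * |C2| + |K|) (|C| * Real.sqrt N₀), fun N r hr τ hτ hrτ => ?_⟩
  rcases lt_or_ge N N₀ with hN | hN
  · -- small `N`: the energy-only bound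
    refine (hC N r τ hτ).trans (ENNReal.ofReal_le_ofReal (le_trans ?_ (le_max_right _ _)))
    have h1 : Real.sqrt ((N + 1 : ℕ) : ℝ) ≤ Real.sqrt N₀ := Real.sqrt_le_sqrt (by exact_mod_cast hN)
    calc C * Real.sqrt ((N + 1 : ℕ) : ℝ) ≤ |C| * Real.sqrt ((N + 1 : ℕ) : ℝ) :=
          mul_le_mul_of_nonneg_right (le_abs_self C) (Real.sqrt_nonneg _)
      _ ≤ |C| * Real.sqrt N₀ := mul_le_mul_of_nonneg_left h1 (abs_nonneg C)
  · -- large `N`: truncation at level `M`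
    set P := localGibbsLaw σ (a τ) (u τ) (θ τ) N (Φ N) with hP
    refine le_trans ?_ (ENNReal.ofReal_le_ofReal (le_max_left _ _))
    calc ∫⁻ z, ENNReal.ofReal ((((N + 1 : ℕ) : ℝ))⁻¹ * ∑ i, ‖((Φ N).flow r z i).2‖ ^ 3) ∂P
        ≤ ∫⁻ z, (ENNReal.ofReal (max M 0) * ENNReal.ofReal ((((N + 1 : ℕ) : ℝ))⁻¹ * ∑ i, ‖((Φ N).flow r z i).2‖ ^ 2) +
            ENNReal.ofReal ((((N + 1 : ℕ) : ℝ))⁻¹ * ∑ i,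
              Set.indicator {v : V3 | M < ‖v‖} (fun v => ‖v‖ ^ 3) ((Φ N).flow r z i).2)) ∂P :=
          lintegral_mono fun z => c3_ofReal_avg_pow_three_flow_le_truncate (Φ N) M r z
      _ = ENNReal.ofReal (max M 0) * ∫⁻ z, ENNReal.ofReal ((((N + 1 : ℕ) : ℝ))⁻¹ * ∑ i, ‖((Φ N).flow r z i).2‖ ^ 2) ∂P +
            ∫⁻ z, ENNReal.ofReal ((((N + 1 : ℕ) : ℝ))⁻¹ * ∑ i,
              Set.indicator {v : V3 | M < ‖v‖} (fun v => ‖v‖ ^ 3) ((Φ N).flow r z i).2) ∂P := by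
          rw [lintegral_add_left ((c3_measurable_avg_pow_flow (Φ N) r 2).const_mul _),
            lintegral_const_mul _ (c3_measurable_avg_pow_flow (Φ N) r 2)]
      _ ≤ ENNReal.ofReal (max M 0) * ENNReal.ofReal |C2| + ENNReal.ofReal |K| :=
          add_le_add (mul_le_mul' le_rfl ((hC2 N r τ hτ).trans (ENNReal.ofReal_le_ofReal (le_abs_self _))))
            ((htail N hN r hr τ hτ hrτ).trans (ENNReal.ofReal_le_ofReal (le_abs_self _)))
      _ = ENNReal.ofReal (max M 0 * |C2| + |K|) := by
          rw [← ENNReal.ofReal_mul hM, ← ENNReal.ofReal_add (mul_nonneg hM (abs_nonneg _)) (abs_nonneg _)]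

end Summit.AtomisticToContinuum.HydrodynamicLimit.Theorems.RestartPrinciple.AgeDuhamelForgetting

end
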